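import Literature.Computability.Cryptography.VanDamSeroussiOracleFP
import Literature.Computability.Cryptography.QSolvableParitySum
import Literature.Computability.Cryptography.ShorDiscreteLogTheorem
import Literature.Computability.Cryptography.ShorAssemblyLeavesProofs
import Literature.Computability.QuantumComplexity.CWrapAssembly
import HarnessLib

/-!
# The classical oracle of the van Dam–Seroussi circuit, III: the language is in `BQP`

Topic `Literature/Computability/Cryptography`, sequel of `VanDamSeroussiOracle.lean` (the language
`VDSOracle.lang`) and `VanDamSeroussiOracleFP.lean` (its polynomial-time parts). The two quantum
tags are Shor's problems: tag `FACT` asks a bit of the code of the prime factorisation of `p − 1`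
(Shor 1997, §5; the tree's `isQSolvable_factoring_holds`), tag `DLOG` a bit of a discrete logarithm on
a CERTIFIED instance (Shor 1997, §6; the tree's `isQSolvable_dlog_holds`). One bounded-error quantum
machine serves both (Bernstein–Vazirani 1997, §8: classical control inside a quantum machine):

* `VDSOracle.innerRel`, **`isQSolvable_innerRel`** — the discrete-logarithm solver on inputs of even
  length and the factoring solver on inputs of odd length (`IsQSolvable.paritySum`), each reading its
  instance in the first field of the input (`isQSolvable_comp_fstF`, one classical wrap);
* `VDSOracle.preSpec` (the query ↦ the padded instance) with `codeFP_preSpec`, and the post-processor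
  `VDSOracle.postBit` with `codeFP_postBit` — the certificate check, the prefix scan
  (`dlogAny_eq_testBit_dlog`), the factor-list parse (`factBit_of_prefix`), the arithmetic tags;
* **`postBit_eq_specBit`** — on every output the inner machine may produce, the post-processor returns
  exactly the answer bit of the language (the certificate makes the promise of the discrete-logarithm
  problem DECIDABLE, so that off the promise the answer is the constant `false`);
* **`VDSOracle.lang_mem_BQP`** — by the classical wrap (`isQSolvable_classicalWrap_holds`) and
  `mem_BQP_of_isQSolvable_bit`.

Everything is proved; the four definitions have bodies; no named fact.

## References

* P. W. Shor, SIAM J. Comput. 26 (1997) 1484–1509, §5, §6 [Shor1997].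
* E. Bernstein, U. Vazirani, *Quantum complexity theory*, SIAM J. Comput. 26 (1997), §8 [BernsteinVazirani1997].
* C. H. Bennett, E. Bernstein, G. Brassard, U. Vazirani, SIAM J. Comput. 26 (1997), Cor. 4.15
  [BennettBernsteinBrassardVazirani1997].
* W. van Dam, G. Seroussi, arXiv:quant-ph/0207131 (2002), §3 Lemma 1 [VanDamSeroussi2002].
-/

noncomputable section

namespace Literature.Computability.Cryptography

namespace VDSOracle

open _root_.Computability Complexity Complexity.Brick Complexity.CodeFP Complexity.ModArith

/-! ### The inner relation -/

/-- **A solver reading its instance in the first field**: if `R` is solvable then so is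
`u ↦ {z : some y ∈ R (fst u) is a prefix of z}` (classical wrap with `h = fst`, `g = snd`).
[cite: BernsteinVazirani1997, §8] -/
theorem isQSolvable_comp_fstF {R : List Bool → Set (List Bool)} (h : IsQSolvable R) :
    IsQSolvable fun u => {z | ∃ y ∈ R (fstF u), y <+: z} := by
  have hw := isQSolvable_classicalWrap_holds fstF sndF fstF_mem_FP sndF_mem_FP h
  refine hw.mono fun u z hz => ?_
  obtain ⟨y, hy, hz⟩ := hz
  refine ⟨y, hy, ?_⟩
  change sndF (boolPair u y) <+: z at hz
  rwa [sndF_boolPair] at hz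

/-- **The inner relation**: on inputs of even length, discrete logarithms of the instance in the
first field (Shor 1997, §6, the tree's `isQSolvable_dlog`); on inputs of odd length, the prime
factorisation of the number in the first field (Shor 1997, §5, `isQSolvable_factoring`).
[cite: Shor1997, §5 and §6] -/
def innerRel (u : List Bool) : Set (List Bool) :=
  if Even u.length then
    {z | ∃ y ∈ {out : List Bool | ∀ p g y : ℕ, fstF u = encodeDLogInstance p g y →
        IsDLogInstance p g y → ∃ a ∈ dlogSolutions p g y, encodeNat a <+: out}, y <+: z}
  else {z | ∃ y ∈ {y : List Bool | encodingListNatBool.encode (decodeNat (fstF u)).primeFactorsList <+: y}, y <+: z}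

/-- **The inner relation is solvable in bounded-error quantum polynomial time.**
[cite: Shor1997, §5 and §6] [cite: BernsteinVazirani1997, §8] -/
theorem isQSolvable_innerRel : IsQSolvable innerRel := by
  have hD : IsQSolvable fun x => {out : List Bool | ∀ p g y : ℕ, x = encodeDLogInstance p g y →
      IsDLogInstance p g y → ∃ a ∈ dlogSolutions p g y, encodeNat a <+: out} := isQSolvable_dlog_holds
  have hF : IsQSolvable fun x => {y : List Bool | encodingListNatBool.encode (decodeNat x).primeFactorsList <+: y} :=
    isQSolvable_factoring_holds
  exact (isQSolvable_comp_fstF hD).paritySum (isQSolvable_comp_fstF hF)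

/-! ### The pre-processor -/

/-- **The pre-processor**: a discrete-logarithm query is sent to the instance
`⟨bin p, ⟨bin (g mod p), bin y⟩⟩` padded to even length, every other query to `bin (p − 1)` padded to
odd length. [cite: Shor1997, §5 and §6] -/
def preSpec (w : List Bool) : List Bool :=
  if (parse w).tag = tagDLOG then
    boolPair (encodeDLogInstance (parse w).p ((parse w).g % (parse w).p) (bitsToNat (parse w).r2)) []
  else boolPair (encodeNat ((parse w).p - 1)) [false]

/-- The instance code as nested pairs of numerals. [folklore] -/
theorem encodeDLogInstance_eq (p g y : ℕ) :
    encodeDLogInstance p g y = pairE natE (pairE natE natE) (p, g, y) := rfl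

/-- `fstF` on strings. [folklore] -/
private theorem codeFP_fstF' : CodeFP strE strE fstF := ⟨fstF, fstF_mem_FP, fun _ => rfl⟩

/-- `sndF` on strings. [folklore] -/
private theorem codeFP_sndF' : CodeFP strE strE sndF := ⟨sndF, sndF_mem_FP, fun _ => rfl⟩

/-- **The pre-processor is polynomial time.** [cite: AroraBarak2009, §1.3] -/
theorem codeFP_preSpec : CodeFP strE strE preSpec := by
  obtain ⟨hp, hg, -, -, ht, -⟩ := codeFP_fields
  obtain ⟨-, hr2⟩ := codeFP_regs
  have hP : CodeFP strE natE (fun w => (parse w).p) := hp.comp codeFP_parse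
  have hG : CodeFP strE natE (fun w => (parse w).g % (parse w).p) := natMod.comp ((hg.comp codeFP_parse).pair hP)
  have hY : CodeFP strE natE (fun w => bitsToNat (parse w).r2) := strVal.comp (hr2.comp codeFP_parse)
  have hT : CodeFP strE bitE (fun w => decide ((parse w).tag = tagDLOG)) :=
    (eq unE_injective).comp ((ht.comp codeFP_parse).pair (const _ tagDLOG))
  have hb1 : CodeFP strE strE (fun w => pairE (pairE natE (pairE natE natE)) strE ((((parse w).p, (parse w).g % (parse w).p,
      bitsToNat (parse w).r2)), [])) :=
    (transparent (eα := pairE (pairE natE (pairE natE natE)) strE) (eβ := strE) (g := pairE (pairE natE (pairE natE natE)) strE)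
      fun _ => rfl).comp ((hP.pair (hG.pair hY)).pair (const _ []))
  have hb2 : CodeFP strE strE (fun w => pairE natE strE ((parse w).p - 1, [false])) :=
    (transparent (eα := pairE natE strE) (eβ := strE) (g := pairE natE strE) fun _ => rfl).comp
      ((natSub.comp (hP.pair (const _ 1))).pair (const _ [false]))
  refine (hT.ite hb1 hb2).congr fun w => ?_
  unfold preSpec
  by_cases h : (parse w).tag = tagDLOG
  · rw [decide_eq_true h, if_pos rfl, if_pos h]; rfl
  · rw [decide_eq_false h, if_neg Bool.false_ne_true, if_neg h]; rfl

/-! ### The post-processor -/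

/-- The certificate-and-unit guard of a discrete-logarithm query. [cite: Shor1997, §6] -/
def guardOK (q : Query) : Bool :=
  decide (CertOK q.p (q.g % q.p) (parseF q.r1)) && (decide (0 < bitsToNat q.r2) && decide (bitsToNat q.r2 < q.p))

/-- The guard decides the promise of the discrete-logarithm branch of `valOf`. [folklore] -/
theorem guardOK_eq_true_iff (q : Query) :
    guardOK q = true ↔ CertOK q.p (q.g % q.p) (parseF q.r1) ∧ 0 < bitsToNat q.r2 ∧ bitsToNat q.r2 < q.p := by
  simp [guardOK]

/-- **The post-processor** on the parsed query and the inner machine's output: the factor-list bit,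
the guarded prefix scan, or the arithmetic value. [cite: Shor1997, §5 and §6] [cite: VanDamSeroussi2002, §4 Algorithm 1] -/
def postBit (q : Query) (out : List Bool) : Bool :=
  if q.tag = tagFACT then (certCode (parseF out)).getD q.idx false
  else if q.tag = tagDLOG then
    guardOK q && (((List.range (out.length + 1)).map fun ℓ => bitsToNat (out.take ℓ)).any fun c =>
      (decide (c < q.p - 1) && decide (powM q.p (q.g % q.p) c = bitsToNat q.r2 % q.p)) && c.testBit q.idx)
  else (if q.tag = tagDLOG then 0 else valOf q).testBit q.idx

/-- The certificate-and-unit guard is polynomial time. [cite: Shor1997, §6] -/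
theorem codeFP_guardOK : CodeFP Query.code bitE guardOK := by
  obtain ⟨hp, hg, -⟩ := codeFP_fields
  obtain ⟨hr1, hr2⟩ := codeFP_regs
  have hG : CodeFP Query.code natE (fun q => q.g % q.p) := natMod.comp (hg.pair hp)
  have hY : CodeFP Query.code natE (fun q => bitsToNat q.r2) := strVal.comp hr2
  exact ((codeFP_certOK.comp (hp.pair (hG.pair (codeFP_parseF.comp hr1)))).and
    ((natLt.comp ((const _ 0).pair hY)).and (natLt.comp (hY.pair hp)))).congr fun _ => rfl

/-- The guarded prefix scan of the discrete-logarithm branch is polynomial time (query and output).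
[cite: Shor1997, §6] -/
theorem codeFP_dlogBranch : CodeFP (pairE Query.code strE) bitE (fun t => guardOK t.1 &&
    (((List.range (t.2.length + 1)).map fun ℓ => bitsToNat (t.2.take ℓ)).any fun c =>
      (decide (c < t.1.p - 1) && decide (powM t.1.p (t.1.g % t.1.p) c = bitsToNat t.1.r2 % t.1.p)) && c.testBit t.1.idx)) := by
  obtain ⟨hp, hg, -, -, -, hi, -⟩ := codeFP_fields
  obtain ⟨-, hr2⟩ := codeFP_regs
  have hQ : CodeFP (pairE Query.code strE) Query.code (fun t => t.1) := fst _ _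
  have hout : CodeFP (pairE Query.code strE) strE (fun t => t.2) := snd _ _
  have hP : CodeFP (pairE Query.code strE) natE (fun t => t.1.p) := hp.comp hQ
  have hG : CodeFP (pairE Query.code strE) natE (fun t => t.1.g % t.1.p) := natMod.comp ((hg.comp hQ).pair hP)
  have hI : CodeFP (pairE Query.code strE) natE (fun t => t.1.idx) := hi.comp hQ
  have hY : CodeFP (pairE Query.code strE) natE (fun t => bitsToNat t.1.r2) := strVal.comp (hr2.comp hQ)
  have hany := codeFP_dlogAny.comp ((hP.pair (hG.pair hY)).pair (hI.pair hout))
  exact ((codeFP_guardOK.comp hQ).and hany).congr fun _ => rfl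

/-- **The post-processor is polynomial time** (as a function of the pair `(query, output)`).
[cite: AroraBarak2009, §1.3] -/
theorem codeFP_postBitPair : CodeFP (pairE Query.code strE) bitE (fun t => postBit t.1 t.2) := by
  obtain ⟨-, -, -, -, ht, hi, -⟩ := codeFP_fields
  have hQ : CodeFP (pairE Query.code strE) Query.code (fun t => t.1) := fst _ _
  have hout : CodeFP (pairE Query.code strE) strE (fun t => t.2) := snd _ _
  have hI : CodeFP (pairE Query.code strE) natE (fun t => t.1.idx) := hi.comp hQ
  have hTag : ∀ k : ℕ, CodeFP (pairE Query.code strE) bitE (fun t => decide (t.1.tag = k)) := fun k =>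
    (eq unE_injective).comp ((ht.comp hQ).pair (const _ k))
  -- (no type ascriptions on the composites: elaborating `comp` against an expected function is a
  -- higher-order unification problem that sends the unifier unfolding `List.getD ∘ certCode ∘ parseF`)
  have hfact := codeFP_factBit.comp (hI.pair hout)
  have harith := codeFP_testBit.comp ((codeFP_valOfP.comp hQ).pair hI)
  refine ((hTag tagFACT).ite hfact ((hTag tagDLOG).ite codeFP_dlogBranch harith)).congr fun t => ?_
  dsimp only
  rw [postBit]
  by_cases h0 : t.1.tag = tagFACT
  · rw [decide_eq_true h0, if_pos rfl, if_pos h0]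
  · rw [decide_eq_false h0, if_neg Bool.false_ne_true, if_neg h0]
    by_cases h1 : t.1.tag = tagDLOG
    · rw [decide_eq_true h1, if_pos rfl, if_pos h1]
    · rw [decide_eq_false h1, if_neg Bool.false_ne_true, if_neg h1, if_neg h1]

/-- The post-processor as a function of the string `⟨query, output⟩` is polynomial time. [cite: AroraBarak2009, §1.3] -/
theorem codeFP_postBit : CodeFP strE bitE (fun v => postBit (parse (fstF v)) (sndF v)) :=
  codeFP_postBitPair.comp ((codeFP_parse.comp codeFP_fstF').pair codeFP_sndF')

/-! ### The post-processor returns the answer bit -/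

/-- The length of the padded instances: even for a discrete-logarithm query, odd otherwise. [folklore] -/
theorem even_length_preSpec_iff (w : List Bool) : Even (preSpec w).length ↔ (parse w).tag = tagDLOG := by
  unfold preSpec
  split_ifs with h
  · rw [length_boolPair, List.length_nil]
    exact ⟨fun _ => h, fun _ => ⟨(encodeDLogInstance (parse w).p ((parse w).g % (parse w).p) (bitsToNat (parse w).r2)).length + 1, by ring⟩⟩
  · rw [length_boolPair, List.length_singleton]
    constructor
    · rintro ⟨k, hk⟩; omega
    · exact fun ht => absurd ht h

/-- The code of the factor list is the certificate code. [folklore] -/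
theorem encode_primeFactorsList_eq (F : List ℕ) : encodingListNatBool.encode F = certCode F := by
  rw [show (encodingListNatBool.encode : List ℕ → List Bool) = listE natE from listE_eq encodingNatBool]
  rfl

/-- **The post-processor returns the answer bit of the language** on every output of the inner
machine on the padded instance. [cite: Shor1997, §5 and §6] [cite: VanDamSeroussi2002, §3 Lemma 1] -/
theorem postBit_eq_specBit (w : List Bool) {out : List Bool} (hout : out ∈ innerRel (preSpec w)) :
    postBit (parse w) out = specBit (parse w) := by
  set q := parse w with hq
  by_cases h0 : q.tag = tagFACT
  · -- factoring
    have hne : q.tag ≠ tagDLOG := by rw [h0]; decide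
    have hodd : ¬ Even (preSpec w).length := fun he => hne ((even_length_preSpec_iff w).1 he)
    rw [innerRel, if_neg hodd, Set.mem_setOf_eq] at hout
    obtain ⟨y, hy, hyout⟩ := hout
    have hpre : fstF (preSpec w) = encodeNat (q.p - 1) := by
      rw [preSpec, ← hq, if_neg hne, fstF_boolPair]
    rw [Set.mem_setOf_eq, hpre, Computability.decode_encodeNat, encode_primeFactorsList_eq] at hy
    have hfc : factCode q.p <+: out := (hy.trans hyout)
    rw [postBit, if_pos h0, specBit, if_pos h0, factBit_of_prefix hfc]
  · by_cases h1 : q.tag = tagDLOG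
    · -- discrete logarithm
      have heven : Even (preSpec w).length := (even_length_preSpec_iff w).2 h1
      rw [innerRel, if_pos heven, Set.mem_setOf_eq] at hout
      obtain ⟨y, hy, hyout⟩ := hout
      have hpre : fstF (preSpec w) = encodeDLogInstance q.p (q.g % q.p) (bitsToNat q.r2) := by
        rw [preSpec, ← hq, if_pos h1, fstF_boolPair]
      rw [Set.mem_setOf_eq, hpre] at hy
      rw [postBit, if_neg h0, if_pos h1, specBit, if_neg h0, valOf, if_pos h1]
      by_cases hgd : CertOK q.p (q.g % q.p) (parseF q.r1) ∧ 0 < bitsToNat q.r2 ∧ bitsToNat q.r2 < q.p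
      · have hinst : IsDLogInstance q.p (q.g % q.p) (bitsToNat q.r2) := isDLogInstance_of_certOK hgd.1 hgd.2.1 hgd.2.2
        obtain ⟨a, ha, hay⟩ := hy _ _ _ rfl hinst
        rw [eq_dlog hinst ha] at hay
        rw [(guardOK_eq_true_iff q).2 hgd, Bool.true_and, if_pos hgd, dlogAny_eq_testBit_dlog hinst q.idx (hay.trans hyout)]
      · have hg : guardOK q = false := by
          rw [Bool.eq_false_iff, Ne, guardOK_eq_true_iff]; exact hgd
        rw [hg, Bool.false_and, if_neg hgd, Nat.zero_testBit]
    · -- arithmetic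
      rw [postBit, if_neg h0, if_neg h1, if_neg h1, specBit, if_neg h0]

/-! ### The language is in `BQP` -/

/-- **The oracle language of the van Dam–Seroussi circuit is in `BQP`.** [cite: Shor1997, §5 and §6] [cite: BernsteinVazirani1997, §8] [cite: BennettBernsteinBrassardVazirani1997, Cor. 4.15] -/
theorem lang_mem_BQP : lang ∈ BQP := by
  -- the two classical maps as `FP` functions
  obtain ⟨h, hh, hh_eq⟩ := codeFP_preSpec
  have hpre : preSpec ∈ FP := by
    have : h = preSpec := funext fun w => hh_eq w
    rw [← this]; exact hh
  obtain ⟨g, hg, hg_eq⟩ := codeFP_postBit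
  -- the wrap
  have hW := isQSolvable_classicalWrap_holds preSpec g hpre hg isQSolvable_innerRel
  have hbit : IsQSolvable fun w => {z | [specBit (parse w)] <+: z} := by
    refine hW.mono fun w z hz => ?_
    obtain ⟨y, hy, hz⟩ := hz
    have hgy : g (boolPair w y) = [specBit (parse w)] := by
      have := hg_eq (boolPair w y)
      dsimp only at this
      rw [fstF_boolPair, sndF_boolPair, postBit_eq_specBit w hy] at this
      exact this
    rw [hgy] at hz
    exact hz
  exact mem_BQP_of_isQSolvable_bit (fun _ _ => QCircuit.outputPMF_apply_holds) cliffordT_isUnitary_holds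
    (fun w => (mem_lang_iff w).symm) hbit

end VDSOracle

end Literature.Computability.Cryptography

end
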